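import HarnessLib
import Summits.Ventures.WeilGRH.CellMod13One
import Summits.Ventures.WeilGRH.RealCharacterSmallModuli
import Summits.Ventures.WeilGRH.KCellsMod13OneA
import Summits.Ventures.WeilGRH.KCellsMod13OneB

/-!
# GRH arm (rh-explicit, venture WeilGRH): Weil positivity on `[−1, 1]` for EVERY non-principal EVEN Dirichlet character mod 13

Cell `rh-explicit`, WEIL TRACK — GRH ARM (engine seat weil-grh-2 gen16).  `(ℤ/13)ˣ = ⟨2⟩` (order 12), `χ(2) = ζ^i`, `ζ = exp(2πi/12)`;
`χ` is even iff `i` is even (`χ(−1) = ζ^{6i}`).  Even, `i ≠ 0`: `i = 2, 10` = the sextic classes `13.4 / 13.10` and `i = 4, 8` = the cubic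
classes `13.3 / 13.9` — the checker-K χ-cells `KCellsMod13OneA/B` (weil-grh-2 gen15/16); `i = 6` = the real character `(13/·)` — the island
`CellMod13One.weilPositivityOnChar_mod_thirteen_one_of_apply_two` (gen13).  The ODD characters mod 13 (`13 ∈ R₁`) are weil-grh-3's format-D-K
lane and are not claimed here.  Pure assembly; RH/GRH-free; standard axioms.
-/

noncomputable section

namespace Summit.Ventures.WeilGRH.OneCompleteMod13Even
open Literature.NumberTheory.LFunctions
open scoped Real

/-- `exp(2πi/12)^6 = −1`. [folklore] -/
theorem zeta_pow_half_mod13 : (Complex.exp (2 * ↑Real.pi * Complex.I / 12)) ^ 6 = -1 := by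
  rw [← Complex.exp_nat_mul, show ((6 : ℕ) : ℂ) * (2 * ↑Real.pi * Complex.I / 12) = ↑Real.pi * Complex.I by push_cast; ring]
  exact Complex.exp_pi_mul_I

/-- ★ **Every non-principal EVEN Dirichlet character mod 13 satisfies Weil positivity on `[−1, 1]`.**
[cite: Weil1952FormulesExplicites, (11) pp. 261–262 and the «lemme» p. 262] -/
theorem weilPositivityOnChar_mod13_one_of_even (χ : DirichletCharacter ℂ 13) (hχ : χ ≠ 1) (he : χ.Even) :
    WeilPositivityOnChar χ 1 := by
  have hz : χ (2 : ZMod 13) ^ 12 = 1 := by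
    rw [← map_pow, show (2 : ZMod 13) ^ 12 = 1 from by decide, map_one]
  have hprim : IsPrimitiveRoot (Complex.exp (2 * ↑Real.pi * Complex.I / 12)) 12 := by
    exact_mod_cast Complex.isPrimitiveRoot_exp 12 (by norm_num)
  obtain ⟨i, hi, hiz⟩ := hprim.eq_pow_of_pow_eq_one hz
  have hm1 : χ (-1) = (Complex.exp (2 * ↑Real.pi * Complex.I / 12)) ^ (i * 6) := by
    rw [pow_mul, hiz, ← map_pow, show (2 : ZMod 13) ^ 6 = -1 from by decide]
  have he1 : χ (-1) = 1 := he
  interval_cases i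
  · exact absurd (RealCharacterSmallModuli.eq_one_of_apply_gen RealCharacterSmallModuli.units_mod_thirteen_gen (by rw [← hiz, pow_zero])) hχ
  · exfalso; rw [hm1, show 1 * 6 = 6 from rfl, zeta_pow_half_mod13] at he1; norm_num at he1
  · exact KCellsMod13OneA.weilPositivityOnChar_mod13_chi4_one χ hiz.symm
  · exfalso; rw [hm1, show 3 * 6 = 6 * 3 from rfl, pow_mul, zeta_pow_half_mod13] at he1; norm_num at he1
  · exact KCellsMod13OneB.weilPositivityOnChar_mod13_chi3_one χ hiz.symm
  · exfalso; rw [hm1, show 5 * 6 = 6 * 5 from rfl, pow_mul, zeta_pow_half_mod13] at he1; norm_num at he1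
  · exact CellMod13One.weilPositivityOnChar_mod_thirteen_one_of_apply_two χ (by rw [← hiz, zeta_pow_half_mod13])
  · exfalso; rw [hm1, show 7 * 6 = 6 * 7 from rfl, pow_mul, zeta_pow_half_mod13] at he1; norm_num at he1
  · exact KCellsMod13OneB.weilPositivityOnChar_mod13_chi3_one_conj χ hiz.symm
  · exfalso; rw [hm1, show 9 * 6 = 6 * 9 from rfl, pow_mul, zeta_pow_half_mod13] at he1; norm_num at he1
  · exact KCellsMod13OneA.weilPositivityOnChar_mod13_chi4_one_conj χ hiz.symm
  · exfalso; rw [hm1, show 11 * 6 = 6 * 11 from rfl, pow_mul, zeta_pow_half_mod13] at he1; norm_num at he1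

end Summit.Ventures.WeilGRH.OneCompleteMod13Even

end
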